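import Literature.NumberTheory.LFunctions.ClassGroupLogFreeMiddleRange
import Literature.NumberTheory.LFunctions.ClassGroupLFunctionExceptionalZero
import HarnessLib

/-!
# Bombieri's Théorème 14 for the class group characters of a number field, III: assembly

Topic `Literature/NumberTheory/LFunctions`, namespace `Literature.NumberTheory.LFunctions.NumberField`.
Everything here is PROVED (theorems only; no named facts).

The class-group analogue of the tree's `LogFreeDensity.logFreeDensity_dirichlet` (Bombieri,
*Le grand crible*, §6, THÉORÈME 14: "`Σ_{q ≤ T} Σ*_χ N(α, T; χ) ≤ c₃ T^{c₂(1−α)}`") for the family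
`{L₀(s, χ)}_{χ ∈ Ĉl_K, χ ≠ 1}` of a number field `K` of degree `n ≤ 4` (with a size parameter
`P ≥ 2` dominating `|d_K|`, `h_K`, `1/κ_K` and the heights):

* `smallRange_CG` — for `1 − α < c₁/log P` the count is `≤ 1` (the Landau–Page package of the tree
  for `Ĉl_K`, `exists_exceptionalZero_const`: zero-free region, uniqueness and simplicity of the
  exceptional zero);
* `largeRange_CG` — the trivial bound `≤ C P³` for the zeros with `1/4 ≤ β < 1`, `|γ| ≤ P`
  (Jensen discs at the integer heights, `sum_discDivisor_classGroupLFunction₀_le`);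
* `logFreeDensity_classGroup` — **the log-free zero-density estimate**:
  `Σ_{χ ≠ 1} Σ_{ρ ∈ Z(χ), β ≥ α} m(ρ) ≤ C_D P^{c_D(1−α)}` for finite sets `Z(χ)` of zeros of `L₀(s, χ)`
  in `1/4 ≤ β < 1`, `|γ| ≤ P`, all `0 ≤ α ≤ 1` (middle range: `middleRange_CG`).

## References

* [Bombieri1987GrandCrible] E. Bombieri, Astérisque 18 (1987), §6 Théorème 14.
* [ThornerZaman2017] J. Thorner, A. Zaman, Algebra Number Theory 11 (2017), §5–6 (log-free zero density
  for Hecke `L`-functions).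
* [ThornerZaman2019] J. Thorner, A. Zaman, Algebra Number Theory 13 (2019), Theorems 3.1–3.2.
-/

noncomputable section

open Complex Finset Filter Real MeasureTheory
open scoped LSeries.notation ArithmeticFunction.vonMangoldt Topology Nat

namespace Literature.NumberTheory.LFunctions.NumberField

open Literature.NumberTheory.LFunctions.LogFreeLocal Literature.NumberTheory.LFunctions.LogFreeDensity
  Literature.NumberTheory.LFunctions.AbelianDensity
open scoped nonZeroDivisors _root_.NumberField

/-! ### The range `1 − α < c₁/log P`: at most one zero (Landau–Page for `Ĉl_K`) -/

/-- A zero of `L₀(·, χ)` of analytic order `1` has `zeroOrder = 1`. [folklore] -/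
theorem zeroOrder_eq_one_of_analyticOrderAt {K : Type*} [Field K] [NumberField K] {χ : ClassGroup (𝓞 K) →* ℂˣ}
    {ρ : ℂ} (h : analyticOrderAt (classGroupLFunction₀ K χ) ρ = 1) :
    zeroOrder (classGroupLFunction₀ K χ) ρ = 1 := by
  have hne : analyticOrderAt (classGroupLFunction₀ K χ) ρ ≠ ⊤ := by rw [h]; exact ENat.one_ne_top
  have : (zeroOrder (classGroupLFunction₀ K χ) ρ : ℕ∞) = 1 := by
    rw [zeroOrder, Nat.cast_analyticOrderNatAt hne, h]
  exact_mod_cast this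

open scoped Classical in
/-- **Théorème 14 for `α` within `c₁/log P` of `1`**, for `Ĉl_K` (Bombieri p. 48 via Landau–Page):
for every degree `n` there is `c₁ > 0` such that for every `K` of degree `n`, `P ≥ 2` with
`|d_K| ≤ P`, finite sets `Z(χ)` of zeros of `L₀(s, χ)` (`χ ≠ 1`) with `|γ| ≤ P`, and `1 − α < c₁/log P`,
the multiplicity-weighted count of the zeros with `β ≥ α` over all `χ ≠ 1` is at most `1`.
[cite: ThornerZaman2019, Theorem 3.1] -/
theorem smallRange_CG (n : ℕ) :
    ∃ c₁ : ℝ, 0 < c₁ ∧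
      ∀ (K : Type) [Field K] [NumberField K], Module.finrank ℚ K = n →
        ∀ P : ℝ, 2 ≤ P → ((NumberField.discr K).natAbs : ℝ) ≤ P →
        ∀ Z : (ClassGroup (𝓞 K) →* ℂˣ) → Finset ℂ,
          (∀ χ : ClassGroup (𝓞 K) →* ℂˣ, χ ≠ 1 → ∀ ρ ∈ Z χ, classGroupLFunction₀ K χ ρ = 0 ∧ |ρ.im| ≤ P) →
        ∀ α : ℝ, 1 - α < c₁ / Real.log P →
          ∑ ψ : AddChar (Additive (ClassGroup (𝓞 K))) ℂ with ψ ≠ 0,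
            ∑ ρ ∈ Z (toMulHom ψ).toHomUnits with α ≤ ρ.re,
              (zeroOrder (classGroupLFunction₀ K (toMulHom ψ).toHomUnits) ρ : ℝ) ≤ 1 := by
  obtain ⟨c, hc, hpack⟩ := exists_exceptionalZero_const n
  refine ⟨c / 4, by positivity, fun K _ _ hK P hP hd Z hZ α hα => ?_⟩
  obtain ⟨hreal, huniq, hsimple⟩ := hpack K hK
  have hPpos : 0 < P := by linarith
  set Lp : ℝ := Real.log P with hLp
  have hLp2 : Real.log 2 ≤ Lp := Real.log_le_log (by norm_num) hP
  have hlog2 : (0.69 : ℝ) ≤ Real.log 2 := by have := Real.log_two_gt_d9; linarith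
  have hLppos : 0 < Lp := by linarith
  -- the counted zeros are in the Landau–Page region
  have hregion : ∀ ψ : AddChar (Additive (ClassGroup (𝓞 K))) ℂ, ψ ≠ 0 →
      ∀ ρ ∈ Z (toMulHom ψ).toHomUnits, α ≤ ρ.re →
        ((((toMulHom ψ).toHomUnits = 1 → dedekindZeta₁ K ρ = 0) ∧
          ((toMulHom ψ).toHomUnits ≠ 1 → classGroupLFunction₀ K (toMulHom ψ).toHomUnits ρ = 0)) ∧
          1 - c / (Real.log ((NumberField.discr K).natAbs : ℝ) + Real.log (|ρ.im| + 4)) < ρ.re) := by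
    intro ψ hψ ρ hρ hαρ
    have hχ1 : (toMulHom ψ).toHomUnits ≠ 1 := toHomUnits_ne_one hψ
    obtain ⟨h0, him⟩ := hZ _ hχ1 ρ hρ
    refine ⟨⟨fun h ↦ absurd h hχ1, fun _ ↦ h0⟩, ?_⟩
    -- `log|d| + log(|γ|+4) ≤ 4 log P`
    have hℒ : Real.log ((NumberField.discr K).natAbs : ℝ) + Real.log (|ρ.im| + 4) ≤ 4 * Lp := by
      have hd1 : (1 : ℝ) ≤ ((NumberField.discr K).natAbs : ℝ) := one_le_natAbs_discr
      have h1 : Real.log ((NumberField.discr K).natAbs : ℝ) ≤ Lp := Real.log_le_log (by linarith) hd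
      have h2 : Real.log (|ρ.im| + 4) ≤ Real.log (3 * P) := Real.log_le_log (by positivity) (by linarith)
      rw [Real.log_mul (by norm_num) hPpos.ne'] at h2
      have h3 : Real.log 3 ≤ 1.2 := by
        have he := Real.exp_one_gt_d9
        have hpos : (0 : ℝ) < 3 / Real.exp 1 := by positivity
        have h := Real.log_le_sub_one_of_pos hpos
        rw [Real.log_div (by norm_num) (Real.exp_pos 1).ne', Real.log_exp] at h
        have h4 : 3 / Real.exp 1 ≤ 3 / 2.7 := div_le_div_of_nonneg_left (by norm_num) (by norm_num) (by linarith)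
        norm_num at h4
        linarith
      nlinarith
    have hℒpos : 0 < Real.log ((NumberField.discr K).natAbs : ℝ) + Real.log (|ρ.im| + 4) := by
      have : 0 ≤ Real.log ((NumberField.discr K).natAbs : ℝ) := Real.log_natCast_nonneg _
      have : 1 ≤ Real.log (|ρ.im| + 4) := by
        rw [Real.le_log_iff_exp_le (by positivity)]
        have := Real.exp_one_lt_d9; have := abs_nonneg ρ.im; linarith
      linarith
    have h4 : c / 4 / Lp ≤ c / (Real.log ((NumberField.discr K).natAbs : ℝ) + Real.log (|ρ.im| + 4)) := by
      rw [div_div]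
      exact div_le_div_of_nonneg_left hc.le hℒpos (by linarith)
    linarith
  -- the set of counted pairs has at most one element, of multiplicity one
  set U := (univ : Finset (AddChar (Additive (ClassGroup (𝓞 K))) ℂ)).filter (fun ψ ↦ ψ ≠ 0) with hU
  set W : AddChar (Additive (ClassGroup (𝓞 K))) ℂ → Finset ℂ := fun ψ ↦
    (Z (toMulHom ψ).toHomUnits).filter (fun ρ ↦ α ≤ ρ.re) with hW
  have hone : ∀ ψ ∈ U, ∀ ρ ∈ W ψ, (zeroOrder (classGroupLFunction₀ K (toMulHom ψ).toHomUnits) ρ : ℝ) = 1 := by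
    intro ψ hψ ρ hρ
    rw [hU, mem_filter] at hψ
    rw [hW, mem_filter] at hρ
    have hχ1 : (toMulHom ψ).toHomUnits ≠ 1 := toHomUnits_ne_one hψ.2
    have h := (hsimple _ ρ (hregion ψ hψ.2 ρ hρ.1 hρ.2)).2 hχ1
    rw [zeroOrder_eq_one_of_analyticOrderAt h, Nat.cast_one]
  have hsingle : (U.sigma W).card ≤ 1 := by
    refine Finset.card_le_one.mpr ?_
    rintro ⟨ψ₁, ρ₁⟩ h₁ ⟨ψ₂, ρ₂⟩ h₂
    rw [Finset.mem_sigma] at h₁ h₂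
    rw [hU, mem_filter] at h₁ h₂
    rw [hW, mem_filter] at h₁ h₂
    obtain ⟨hχ, hρ⟩ := huniq _ _ _ _ (hregion ψ₁ h₁.1.2 ρ₁ h₁.2.1 h₁.2.2) (hregion ψ₂ h₂.1.2 ρ₂ h₂.2.1 h₂.2.2)
    have hψ : ψ₁ = ψ₂ := toHomUnits_toMulHom_injective (K := K) hχ
    subst hψ; subst hρ; rfl
  calc ∑ ψ ∈ U, ∑ ρ ∈ W ψ, (zeroOrder (classGroupLFunction₀ K (toMulHom ψ).toHomUnits) ρ : ℝ)
      = ∑ ψ ∈ U, ∑ ρ ∈ W ψ, (1 : ℝ) := sum_congr rfl fun ψ hψ ↦ sum_congr rfl fun ρ hρ ↦ hone ψ hψ ρ hρ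
    _ = ((U.sigma W).card : ℝ) := by rw [Finset.sum_sigma', sum_const, nsmul_eq_mul, mul_one]
    _ ≤ 1 := by exact_mod_cast hsingle

/-! ### The trivial range: all the zeros with `1/4 ≤ β < 1`, `|γ| ≤ P` -/

open scoped Classical in
/-- **The trivial bound**: there is an absolute `C` such that for every `K` with `n_K ≤ 4`, `P ≥ 2`
with `|d_K| ≤ P` and `h_K ≤ P`, and finite sets `Z(χ)` of zeros of `L₀(s, χ)` (`χ ≠ 1`) with
`1/4 ≤ β ≤ 1` and `|γ| ≤ P`: `Σ_{χ ≠ 1} Σ_{ρ ∈ Z(χ)} m(ρ) ≤ C P³` (each zero lies in the Jensen disc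
`|ρ − (2 + ij)| ≤ 31/16` about the nearest integer height `j`, whose count is `≤ 128 · discBound ≤ C log P`).
[cite: Bombieri1987GrandCrible, §6 Théorème 14 (proof)] -/
theorem largeRange_CG :
    ∃ C : ℝ, 0 < C ∧
      ∀ (K : Type*) [Field K] [NumberField K], Module.finrank ℚ K ≤ 4 →
        ∀ P : ℝ, 2 ≤ P → ((NumberField.discr K).natAbs : ℝ) ≤ P → (Fintype.card (ClassGroup (𝓞 K)) : ℝ) ≤ P →
        ∀ Z : (ClassGroup (𝓞 K) →* ℂˣ) → Finset ℂ,
          (∀ χ : ClassGroup (𝓞 K) →* ℂˣ, χ ≠ 1 → ∀ ρ ∈ Z χ,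
              classGroupLFunction₀ K χ ρ = 0 ∧ 1 / 4 ≤ ρ.re ∧ ρ.re ≤ 1 ∧ |ρ.im| ≤ P) →
          ∑ ψ : AddChar (Additive (ClassGroup (𝓞 K))) ℂ with ψ ≠ 0,
            ∑ ρ ∈ Z (toMulHom ψ).toHomUnits,
              (zeroOrder (classGroupLFunction₀ K (toMulHom ψ).toHomUnits) ρ : ℝ) ≤ C * P ^ (3 : ℕ) := by
  refine ⟨128 * 44 * 5, by norm_num, fun K _ _ hnK P hP hd hh Z hZ => ?_⟩
  have hPpos : 0 < P := by linarith
  set Lp : ℝ := Real.log P with hLp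
  have hLp2 : Real.log 2 ≤ Lp := Real.log_le_log (by norm_num) hP
  have hlog2 : (0.69 : ℝ) ≤ Real.log 2 := by have := Real.log_two_gt_d9; linarith
  have hLppos : 0 < Lp := by linarith
  have hLpP : Lp ≤ P := by rw [hLp]; exact (Real.log_le_sub_one_of_pos hPpos).trans (by linarith)
  -- the windows
  set M : ℤ := ⌈P⌉ + 1 with hM
  have hMle : (M : ℝ) ≤ P + 2 := by
    rw [hM]; push_cast; linarith [(Int.ceil_lt_add_one P).le]
  set J : Finset ℤ := Finset.Icc (-M) M with hJ
  have hM0 : 0 ≤ M := by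
    rw [hM]; have := Int.ceil_nonneg hPpos.le; omega
  have hcardJ : (J.card : ℝ) ≤ 5 * P := by
    have : (J.card : ℤ) = 2 * M + 1 := by
      rw [hJ, Int.card_Icc]; omega
    have hc : (J.card : ℝ) = 2 * M + 1 := by exact_mod_cast this
    rw [hc]; linarith
  -- `discBound K j ≤ 44 Lp` at the heights `|j| ≤ M ≤ P + 2`
  have hdiscj : ∀ j ∈ J, discBound K j ≤ 44 * Lp := by
    intro j hj
    rw [hJ, Finset.mem_Icc] at hj
    have hjabs : |(j : ℝ)| ≤ P + 2 := by
      rw [abs_le]; constructor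
      · have : (-M : ℝ) ≤ j := by exact_mod_cast hj.1
        linarith
      · have : (j : ℝ) ≤ M := by exact_mod_cast hj.2
        linarith
    -- as in `lemmaAHeight_le`
    have hn4 : (Module.finrank ℚ K : ℝ) ≤ 4 := by exact_mod_cast hnK
    have hn0 : (0 : ℝ) ≤ Module.finrank ℚ K := Nat.cast_nonneg _
    have hd1 : (1 : ℝ) ≤ ((NumberField.discr K).natAbs : ℝ) := one_le_natAbs_discr
    have hlogd : Real.log ((NumberField.discr K).natAbs : ℝ) ≤ Lp := Real.log_le_log (by linarith) hd
    have hlogv : Real.log (|(j : ℝ)| + 7) ≤ 5 * Lp := by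
      have h1 : Real.log (|(j : ℝ)| + 7) ≤ Real.log (6 * P) := Real.log_le_log (by positivity) (by linarith)
      rw [Real.log_mul (by norm_num) hPpos.ne'] at h1
      have h5 : Real.log 6 ≤ 2 := by
        have : Real.log 6 ≤ Real.log (Real.exp 2) := by
          refine Real.log_le_log (by norm_num) ?_
          have := Real.exp_one_gt_d9
          have h : Real.exp 2 = Real.exp 1 * Real.exp 1 := by rw [← Real.exp_add]; norm_num
          rw [h]; nlinarith
        rwa [Real.log_exp] at this
      nlinarith
    have hlv0 : 0 ≤ Real.log (|(j : ℝ)| + 7) := le_trans zero_le_one (one_le_log_abs_add_seven (j : ℝ))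
    rw [discBound]
    have hprod : ((Module.finrank ℚ K : ℝ) + 1) * Real.log (|(j : ℝ)| + 7) ≤ 5 * (5 * Lp) :=
      mul_le_mul (by linarith) hlogv hlv0 (by norm_num)
    nlinarith
  -- per character
  have hper : ∀ ψ : AddChar (Additive (ClassGroup (𝓞 K))) ℂ, ψ ≠ 0 →
      ∑ ρ ∈ Z (toMulHom ψ).toHomUnits, (zeroOrder (classGroupLFunction₀ K (toMulHom ψ).toHomUnits) ρ : ℝ) ≤
        (5 * P) * (128 * (44 * Lp)) := by
    intro ψ hψ
    set χ := (toMulHom ψ).toHomUnits with hχ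
    have hχ1 : χ ≠ 1 := toHomUnits_ne_one hψ
    set f := classGroupLFunction₀ K χ with hf
    have hdf : Differentiable ℂ f := differentiable_classGroupLFunction₀ χ
    -- fibres over the nearest integer to `γ`
    set g : ℂ → ℤ := fun ρ => ⌊ρ.im + 1 / 2⌋ with hg
    have hmaps : ∀ ρ ∈ Z χ, g ρ ∈ J := by
      intro ρ hρ
      obtain ⟨-, -, -, him⟩ := hZ χ hχ1 ρ hρ
      rw [hJ, Finset.mem_Icc, hg]; dsimp only
      have h1 := abs_le.1 him
      have hc1 : (⌈P⌉ : ℝ) ≥ P := Int.le_ceil _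
      constructor
      · rw [hM]
        have : (-(⌈P⌉ + 1) : ℤ) ≤ ⌊ρ.im + 1 / 2⌋ := by
          rw [Int.le_floor]; push_cast; linarith
        linarith
      · rw [hM]
        have : ⌊ρ.im + 1 / 2⌋ ≤ (⌈P⌉ + 1 : ℤ) := by
          have : ⌊ρ.im + 1 / 2⌋ < ⌈P⌉ + 1 + 1 := by
            rw [Int.floor_lt]; push_cast; linarith
          omega
        exact this
    -- each fibre lies in the Jensen disc about `2 + ij`
    have hfib : ∀ j ∈ J, ∑ ρ ∈ (Z χ).filter (fun ρ => g ρ = j), (zeroOrder f ρ : ℝ) ≤ 128 * (44 * Lp) := by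
      intro j hj
      have hfc : f (2 + ((j : ℝ) : ℂ) * I) ≠ 0 := classGroupLFunction₀_two_add_ne_zero hχ1 (j : ℝ)
      have hsub : (Z χ).filter (fun ρ => g ρ = j) ⊆ discZeros f (j : ℝ) := by
        intro ρ hρ
        rw [mem_filter] at hρ
        obtain ⟨h0, hβ, hβ1, -⟩ := hZ χ hχ1 ρ hρ.1
        refine (mem_discZeros hdf hfc).2 ⟨?_, h0⟩
        rw [Metric.mem_closedBall, dist_eq_norm]
        have hγ : |ρ.im - j| ≤ 1 / 2 := by
          have hgj := hρ.2
          rw [hg] at hgj; dsimp only at hgj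
          have h1 := Int.floor_le (ρ.im + 1 / 2)
          have h2 := Int.lt_floor_add_one (ρ.im + 1 / 2)
          rw [hgj] at h1 h2
          rw [abs_le]; constructor <;> linarith
        have hre : (ρ - (2 + ((j : ℝ) : ℂ) * I)).re = ρ.re - 2 := by simp
        have him' : (ρ - (2 + ((j : ℝ) : ℂ) * I)).im = ρ.im - j := by simp
        have hsq : ‖ρ - (2 + ((j : ℝ) : ℂ) * I)‖ ^ 2 ≤ (31 / 16 : ℝ) ^ 2 := by
          rw [Complex.sq_norm, Complex.normSq_apply, hre, him']
          have h1 : (ρ.re - 2) * (ρ.re - 2) ≤ (7 / 4) ^ 2 := by nlinarith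
          have h2 : (ρ.im - j) * (ρ.im - j) ≤ (1 / 2) ^ 2 := by
            have := abs_le.1 hγ; nlinarith
          nlinarith
        nlinarith [norm_nonneg (ρ - (2 + ((j : ℝ) : ℂ) * I))]
      calc ∑ ρ ∈ (Z χ).filter (fun ρ => g ρ = j), (zeroOrder f ρ : ℝ)
          = ∑ ρ ∈ (Z χ).filter (fun ρ => g ρ = j), (discDivisor f (j : ℝ) ρ : ℝ) := by
            refine sum_congr rfl fun ρ hρ => ?_
            rw [discDivisor_eq_zeroOrder hdf hfc ((mem_discZeros hdf hfc).1 (hsub hρ)).1]; norm_cast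
        _ ≤ ∑ ρ ∈ discZeros f (j : ℝ), (discDivisor f (j : ℝ) ρ : ℝ) :=
            sum_le_sum_of_subset_of_nonneg hsub fun ρ _ _ => by exact_mod_cast discDivisor_nonneg hdf _ ρ
        _ ≤ 128 * discBound K (j : ℝ) := sum_discDivisor_classGroupLFunction₀_le hχ1 _
        _ ≤ 128 * (44 * Lp) := mul_le_mul_of_nonneg_left (hdiscj j hj) (by norm_num)
    rw [← Finset.sum_fiberwise_of_maps_to hmaps]
    calc ∑ j ∈ J, ∑ ρ ∈ (Z χ).filter (fun ρ => g ρ = j), (zeroOrder f ρ : ℝ)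
        ≤ ∑ _j ∈ J, 128 * (44 * Lp) := sum_le_sum hfib
      _ = J.card * (128 * (44 * Lp)) := by rw [sum_const, nsmul_eq_mul]
      _ ≤ (5 * P) * (128 * (44 * Lp)) := mul_le_mul_of_nonneg_right hcardJ (by positivity)
  -- sum over `ψ ≠ 0`: at most `h_K ≤ P` characters
  have hcardψ : (((univ : Finset (AddChar (Additive (ClassGroup (𝓞 K))) ℂ)).filter (fun ψ => ψ ≠ 0)).card : ℝ) ≤ P := by
    calc (((univ : Finset (AddChar (Additive (ClassGroup (𝓞 K))) ℂ)).filter (fun ψ => ψ ≠ 0)).card : ℝ)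
        ≤ (Fintype.card (AddChar (Additive (ClassGroup (𝓞 K))) ℂ) : ℝ) := by
          exact_mod_cast (card_le_card (filter_subset _ _)).trans (Finset.card_univ.le)
      _ = Fintype.card (ClassGroup (𝓞 K)) := by
          rw [card_addChar_classGroup]; rfl
      _ ≤ P := hh
  calc ∑ ψ ∈ (univ : Finset (AddChar (Additive (ClassGroup (𝓞 K))) ℂ)).filter (fun ψ => ψ ≠ 0),
        ∑ ρ ∈ Z (toMulHom ψ).toHomUnits, (zeroOrder (classGroupLFunction₀ K (toMulHom ψ).toHomUnits) ρ : ℝ)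
      ≤ ∑ ψ ∈ (univ : Finset (AddChar (Additive (ClassGroup (𝓞 K))) ℂ)).filter (fun ψ => ψ ≠ 0),
          (5 * P) * (128 * (44 * Lp)) := sum_le_sum fun ψ hψ => hper ψ (mem_filter.1 hψ).2
    _ = (((univ : Finset (AddChar (Additive (ClassGroup (𝓞 K))) ℂ)).filter (fun ψ => ψ ≠ 0)).card : ℝ) *
          ((5 * P) * (128 * (44 * Lp))) := by rw [sum_const, nsmul_eq_mul]
    _ ≤ P * ((5 * P) * (128 * (44 * Lp))) := mul_le_mul_of_nonneg_right hcardψ (by positivity)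
    _ ≤ P * ((5 * P) * (128 * (44 * P))) := by gcongr
    _ = 128 * 44 * 5 * P ^ (3 : ℕ) := by ring

/-! ### Théorème 14 for `Ĉl_K` -/

open scoped Classical in
/-- **The log-free zero-density estimate for the class group `L`-functions of a number field**
(Bombieri's Théorème 14 for the family `{L₀(s, χ)}_{χ ∈ Ĉl_K, χ ≠ 1}`; Thorner–Zaman 2017 §5–6,
2019 Theorem 3.2, for `H = P_K`): for every degree `n ≤ 4` there are `c_D, C_D > 0` such that for
every number field `K` of degree `n` whose `L₀(s, χ)`, `χ ≠ 1`, do not vanish on `Re s ≥ 1`, every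
`P ≥ 2` with `|d_K| ≤ P`, `h_K ≤ P`, `κ_K ≥ 1/P`, all finite sets `Z(χ)` of zeros of `L₀(s, χ)` with
`1/4 ≤ β < 1`, `|γ| ≤ P`, and every `0 ≤ α ≤ 1`,
`Σ_{χ ≠ 1} Σ_{ρ ∈ Z(χ), β ≥ α} m(ρ) ≤ C_D P^{c_D(1−α)}`. [cite: Bombieri1987GrandCrible, §6 Théorème 14] -/
theorem logFreeDensity_classGroup (n : ℕ) (hn : n ≤ 4) :
    ∃ c_D C_D : ℝ, 0 < c_D ∧ 0 < C_D ∧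
      ∀ (K : Type) [Field K] [NumberField K], Module.finrank ℚ K = n →
        (∀ χ : ClassGroup (𝓞 K) →* ℂˣ, χ ≠ 1 → ∀ ρ : ℂ, classGroupLFunction₀ K χ ρ = 0 → ρ.re < 1) →
        ∀ P : ℝ, 2 ≤ P → ((NumberField.discr K).natAbs : ℝ) ≤ P →
          (Fintype.card (ClassGroup (𝓞 K)) : ℝ) ≤ P → P⁻¹ ≤ NumberField.dedekindZeta_residue K →
        ∀ Z : (ClassGroup (𝓞 K) →* ℂˣ) → Finset ℂ,
          (∀ χ : ClassGroup (𝓞 K) →* ℂˣ, χ ≠ 1 → ∀ ρ ∈ Z χ,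
              classGroupLFunction₀ K χ ρ = 0 ∧ 1 / 4 ≤ ρ.re ∧ ρ.re < 1 ∧ |ρ.im| ≤ P) →
          ∀ α : ℝ, 0 ≤ α → α ≤ 1 →
            ∑ ψ : AddChar (Additive (ClassGroup (𝓞 K))) ℂ with ψ ≠ 0,
              ∑ ρ ∈ Z (toMulHom ψ).toHomUnits with α ≤ ρ.re,
                (zeroOrder (classGroupLFunction₀ K (toMulHom ψ).toHomUnits) ρ : ℝ) ≤ C_D * P ^ (c_D * (1 - α)) := by
  obtain ⟨c₁, hc₁, hsmall⟩ := smallRange_CG n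
  obtain ⟨δ₀, A, C, hδ₀, hA, hC, hmid⟩ := middleRange_CG hc₁
  obtain ⟨C₃, hC₃, hlarge⟩ := largeRange_CG
  refine ⟨max A (3 / δ₀), max (max 1 C) C₃, by positivity, by positivity,
    fun K _ _ hK hline P hP hd hh hκ Z hZ α hα0 hα1 => ?_⟩
  have hnK : Module.finrank ℚ K ≤ 4 := hK ▸ hn
  have hP1 : 1 ≤ P := by linarith
  have hexp0 : 0 ≤ max A (3 / δ₀) * (1 - α) := mul_nonneg (by positivity) (by linarith)
  have hPpow1 : 1 ≤ P ^ (max A (3 / δ₀) * (1 - α)) := Real.one_le_rpow hP1 hexp0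
  have hCD1 : 1 ≤ max (max 1 C) C₃ := (le_max_left _ _).trans' (le_max_left _ _)
  rcases lt_or_ge (1 - α) (c₁ / Real.log P) with h1 | h1
  · -- near `α = 1`
    refine (hsmall K hK P hP hd Z (fun χ hχ ρ hρ ↦ ⟨(hZ χ hχ ρ hρ).1, (hZ χ hχ ρ hρ).2.2.2⟩) α h1).trans ?_
    calc (1 : ℝ) ≤ max (max 1 C) C₃ * 1 := by linarith
      _ ≤ _ := mul_le_mul_of_nonneg_left hPpow1 (by positivity)
  rcases le_or_gt (1 - α) δ₀ with h2 | h2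
  · -- the middle range
    refine (hmid K hnK hline P hP hd hh hκ Z (fun χ hχ ρ hρ ↦ ?_) α h1 h2).trans ?_
    · obtain ⟨h0, hβ, hβ1, him⟩ := hZ χ hχ ρ hρ
      exact ⟨h0, by linarith, hβ1, him⟩
    refine mul_le_mul ((le_max_right _ _).trans (le_max_left _ _)) ?_ (by positivity) (by positivity)
    exact Real.rpow_le_rpow_of_exponent_le hP1 (mul_le_mul_of_nonneg_right (le_max_left _ _) (by linarith))
  · -- the trivial range
    have hsub : ∑ ψ : AddChar (Additive (ClassGroup (𝓞 K))) ℂ with ψ ≠ 0,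
        ∑ ρ ∈ Z (toMulHom ψ).toHomUnits with α ≤ ρ.re,
          (zeroOrder (classGroupLFunction₀ K (toMulHom ψ).toHomUnits) ρ : ℝ) ≤
        ∑ ψ : AddChar (Additive (ClassGroup (𝓞 K))) ℂ with ψ ≠ 0,
          ∑ ρ ∈ Z (toMulHom ψ).toHomUnits, (zeroOrder (classGroupLFunction₀ K (toMulHom ψ).toHomUnits) ρ : ℝ) :=
      sum_le_sum fun ψ _ => sum_le_sum_of_subset_of_nonneg (filter_subset _ _) fun ρ _ _ => Nat.cast_nonneg _
    refine hsub.trans ((hlarge K hnK P hP hd hh Z (fun χ hχ ρ hρ ↦ ?_)).trans ?_)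
    · obtain ⟨h0, hβ, hβ1, him⟩ := hZ χ hχ ρ hρ
      exact ⟨h0, hβ, hβ1.le, him⟩
    refine mul_le_mul (le_max_right _ _) ?_ (by positivity) (by positivity)
    rw [← Real.rpow_natCast]
    refine Real.rpow_le_rpow_of_exponent_le hP1 ?_
    push_cast
    have : (3 : ℝ) ≤ 3 / δ₀ * (1 - α) := by
      rw [div_mul_eq_mul_div, le_div_iff₀ hδ₀]; nlinarith
    exact this.trans (mul_le_mul_of_nonneg_right (le_max_right _ _) (by linarith))

end Literature.NumberTheory.LFunctions.NumberField

end
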